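import Literature.MathematicalPhysics.QuantumManyBody.BoseGasSlabDepletionCore
import Literature.MathematicalPhysics.QuantumManyBody.BoseGasDirichletWall
import HarnessLib

/-!
# Wall depletion at a fixed distance for Dirichlet near-minimisers of a dilute Bose gas
# (positive scattering length)

Topic `Literature/MathematicalPhysics/QuantumManyBody`, namespace `…BoseGas`; the thermodynamic
conclusion drawn from the deterministic estimate `slab_le_of_bracketing` of
`BoseGasSlabDepletionCore.lean`.  For a repulsive finite-range pair potential `v` with positive
scattering length `a`, at every sufficiently small density `ρ`, every slab width `0 < s ≤ 1`,
every `θ > 0` and every window parameter `κ > 0`: eventually in `N`, uniformly for boxes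
`L' ∈ [L_N, (1 + κ/N)L_N]` (`L_N = (N/ρ)^{1/3}`), every `1`-near-minimiser `Φ` of the Dirichlet
energy of `N` bosons in `Λ_{L'}` has at most `θN` particles (in expectation) within `s` of any
right wall: `∑ⱼ ∫_{x_{j,a} > L' - s} |Φ|² ≤ θN` (`slabNonConcentration_of_scatteringLength_pos`).

Ingredients fed into the core estimate: the crowding penalty `P = 2πaρ_h` of the Neumann cells
(`exists_crowdedCell_penalty`, from the Lieb–Yngvason bound [LSSY2005, Thm. 2.4] and
superadditivity (2.53)); the Dyson–LSSY upper bound `e⁺(2ρ) ≤ 8πρa(1 + C(2ρa³)^{1/3})`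
(`eventually_groundStateEnergy_le_dyson`), which makes the chord slope of the energy density
negligible against `P` at small `ρ`; the existence of the Dirichlet thermodynamic limit at `ρ`
(`tendsto_energyPerParticleDirichlet_of_lt_criticalDensity`, the `o(N)` precision of `E₀^D(N, L_N)`)
and the continuity of `e⁺` at `ρ` (the boxes of the window realise densities `→ ρ`); finally the
ramp width `δ`, the cell size `ℓ₀` and the slack `ε` are chosen in terms of `θ`, after which the
penalty offsets of the `K²` top cells are `O(L'²) = o(N)`.  (For zero scattering length the
mechanism is different — the free Dirichlet gap — and is not treated here.) No definitions.

## References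

* [LSSY2005] E. H. Lieb, R. Seiringer, J. P. Solovej, J. Yngvason, *The Mathematics of the Bose
  Gas and its Condensation* (2005), Thm. 2.2, Thm. 2.4, (2.52)–(2.58).
* [Ruelle1969] D. Ruelle, *Statistical Mechanics: Rigorous Results* (1969), §3.5.11.
-/

noncomputable section

namespace Literature.MathematicalPhysics.QuantumManyBody.BoseGas

open _root_.MeasureTheory _root_.Filter _root_.Set
open scoped ENNReal NNReal Topology BigOperators

variable {v : ℝ → ℝ≥0∞}

/-- An eventual linear bound on the Dirichlet energies bounds the upper energy per particle:
if `E₀^D(N, L_N(ρ)) ≤ ofReal (C N)` for all large `N` then `e⁺(ρ) ≤ ofReal C`. [folklore] -/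
theorem limsupEnergyPerParticle_le_of_eventually {ρ C : ℝ} (hC : 0 ≤ C)
    (h : ∀ᶠ N : ℕ in atTop, groundStateEnergy v N (sideLength ρ N) ≤ ENNReal.ofReal (C * N)) :
    limsupEnergyPerParticle v ρ ≤ ENNReal.ofReal C := by
  refine Filter.limsup_le_of_le (h := ?_)
  filter_upwards [h, eventually_gt_atTop 0] with N hN hN0
  unfold energyPerParticleDirichlet
  rw [ENNReal.ofReal_mul hC, ENNReal.ofReal_natCast] at hN
  exact ENNReal.div_le_of_le_mul hN

/-- The densities realised by the boxes of the window tend to `ρ`: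
`N / ((1 + κ/N) L_N + 2R)³ → ρ`. [folklore] -/
theorem tendsto_window_density {ρ : ℝ} (hρ : 0 < ρ) {κ R : ℝ} (hκ : 0 ≤ κ) (hR : 0 ≤ R) :
    Tendsto (fun N : ℕ => (N : ℝ) / ((1 + κ / N) * sideLength ρ N + 2 * R) ^ 3) atTop (𝓝 ρ) := by
  have hL := tendsto_sideLength_atTop hρ
  have h1 : Tendsto (fun N : ℕ => (1 + κ / (N : ℝ)) + 2 * R / sideLength ρ N) atTop (𝓝 1) := by
    have hκ' : Tendsto (fun N : ℕ => κ / (N : ℝ)) atTop (𝓝 0) :=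
      tendsto_const_nhds.div_atTop tendsto_natCast_atTop_atTop
    have hR' : Tendsto (fun N : ℕ => 2 * R / sideLength ρ N) atTop (𝓝 0) :=
      tendsto_const_nhds.div_atTop hL
    simpa using (tendsto_const_nhds.add hκ').add hR'
  have h3 : Tendsto (fun N : ℕ => ρ / ((1 + κ / (N : ℝ)) + 2 * R / sideLength ρ N) ^ 3) atTop
      (𝓝 (ρ / (1 : ℝ) ^ 3)) := tendsto_const_nhds.div (h1.pow 3) (by norm_num)
  rw [one_pow, div_one] at h3
  refine h3.congr' ?_
  filter_upwards [eventually_gt_atTop 0] with N hN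
  have hLN : 0 < sideLength ρ N := sideLength_pos_of_pos hρ hN
  have hA : 0 < (1 + κ / (N : ℝ)) + 2 * R / sideLength ρ N := by positivity
  have hNρ : (N : ℝ) / sideLength ρ N ^ 3 = ρ := div_sideLength_pow_three hρ hN
  have : (1 + κ / (N : ℝ)) * sideLength ρ N + 2 * R =
      ((1 + κ / (N : ℝ)) + 2 * R / sideLength ρ N) * sideLength ρ N := by field_simp
  rw [this, mul_pow, mul_comm (((1 + κ / (N : ℝ)) + 2 * R / sideLength ρ N) ^ 3), ← div_div, hNρ]

/-- Bookkeeping: the near-minimality slack `(4/(3P))·1 ≤ θN/4` once `N ≥ 16/(3Pθ)`. [folklore] -/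
theorem slack_term_le {P θ N : ℝ} (hP : 0 < P) (hθ : 0 < θ) (hN : 16 / (3 * P * θ) ≤ N) :
    4 / (3 * P) * 1 ≤ θ * N / 4 := by
  have h : 16 ≤ N * (3 * P * θ) := (div_le_iff₀ (by positivity)).1 hN
  rw [mul_one, div_le_div_iff₀ (by positivity) (by norm_num)]
  nlinarith

/-- Bookkeeping: the localisation error `(4/(3P)) N (π²/(4δ))² ≤ θN/4` once `δ ≥ max 1 (π⁴/(3Pθ))`.
[folklore] -/
theorem ims_term_le {P θ δ N : ℝ} (hP : 0 < P) (hθ : 0 < θ) (hδ1 : 1 ≤ δ)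
    (hδ2 : Real.pi ^ 4 / (3 * P * θ) ≤ δ) (hN : 0 ≤ N) :
    4 / (3 * P) * (N * (Real.pi ^ 2 / (4 * δ)) ^ 2) ≤ θ * N / 4 := by
  have hδ0 : 0 < δ := by linarith
  have h1 : (Real.pi ^ 2 / (4 * δ)) ^ 2 = Real.pi ^ 4 / (16 * δ ^ 2) := by field_simp; ring
  have h2 : Real.pi ^ 4 / (16 * δ ^ 2) ≤ Real.pi ^ 4 / (16 * δ) :=
    div_le_div_of_nonneg_left (by positivity) (by positivity) (by nlinarith)
  have h3 : Real.pi ^ 4 / (16 * δ) ≤ 3 * P * θ / 16 := by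
    rw [div_le_iff₀ (by positivity)] at hδ2 ⊢
    nlinarith
  calc 4 / (3 * P) * (N * (Real.pi ^ 2 / (4 * δ)) ^ 2) ≤ 4 / (3 * P) * (N * (3 * P * θ / 16)) := by
        rw [h1]
        exact mul_le_mul_of_nonneg_left (mul_le_mul_of_nonneg_left (h2.trans h3) hN) (by positivity)
    _ = θ * N / 4 := by field_simp; ring

/-- Bookkeeping: the top-cell offsets `(4/(3P)) 4Pρ_hℓ₀L'² ≤ θN/4` once `L'² ≤ 4L_N²`,
`N = ρL_N³` and `L_N ≥ 1024 ρ_h ℓ₀/(ρθ)`. [folklore] -/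
theorem offset_term_le {P θ ρh ℓ₀ ρ L L' N : ℝ} (hP : 0 < P) (hθ : 0 < θ) (hρh : 0 < ρh)
    (hℓ₀ : 0 < ℓ₀) (hρ : 0 < ρ) (hL : 0 < L) (hL5 : 1024 * ρh * ℓ₀ / (ρ * θ) ≤ L)
    (hL' : L' ^ 2 ≤ 4 * L ^ 2) (hN : N = ρ * L ^ 3) :
    4 / (3 * P) * (4 * P * ρh * ℓ₀ * L' ^ 2) ≤ θ * N / 4 := by
  have h5 : 1024 * ρh * ℓ₀ ≤ L * (ρ * θ) := (div_le_iff₀ (by positivity)).1 hL5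
  calc 4 / (3 * P) * (4 * P * ρh * ℓ₀ * L' ^ 2) = (16 / 3) * (ρh * ℓ₀) * L' ^ 2 := by
        field_simp; ring
    _ ≤ (16 / 3) * (ρh * ℓ₀) * (4 * L ^ 2) := by gcongr
    _ = (1024 * ρh * ℓ₀) * L ^ 2 * (1 / 48) := by ring
    _ ≤ (L * (ρ * θ)) * L ^ 2 * (1 / 48) := by gcongr
    _ ≤ θ * N / 4 := by rw [hN]; nlinarith [pow_pos hL 3, mul_pos hρ hθ]

/-- **Wall depletion at a fixed distance (positive scattering length).**  For a repulsive
finite-range `v` with `a > 0` there is `ρ₀ > 0` such that for `0 < ρ < ρ₀`, every `0 < s ≤ 1`,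
`θ > 0`, `κ > 0`: eventually in `N`, for every `L' ∈ [L_N, (1+κ/N)L_N]`, every Dirichlet trial
state `Φ` of `N` bosons in `Λ_{L'}` with `⟨Φ,HΦ⟩ ≤ E₀^D(N, L') + 1` and every direction `a`,
`∑ⱼ ∫_{x_{j,a} > L'-s} |Φ|² ≤ θN`.
[cite: LSSY2005, Thm. 2.2, Thm. 2.4 and (2.52)–(2.58); Ruelle1969, §3.5.11] -/
theorem slabNonConcentration_of_scatteringLength_pos (hv : IsRepulsiveFiniteRange v)
    (hapos : 0 < scatteringLength v) :
    ∃ ρ₀ : ℝ, 0 < ρ₀ ∧ ∀ ρ : ℝ, 0 < ρ → ρ < ρ₀ → ∀ s : ℝ, 0 < s → s ≤ 1 → ∀ θ : ℝ, 0 < θ →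
      ∀ κ : ℝ, 0 < κ → ∀ᶠ N : ℕ in atTop,
        ∀ L' ∈ Set.Icc (sideLength ρ N) ((1 + κ / N) * sideLength ρ N),
          ∀ Φ : TrialState N L', energy v Φ ≤ groundStateEnergy v N L' + 1 →
            ∀ a : Fin 3, (∑ j : Fin N, ∫⁻ X in {X : Config N | L' - s < X j a},
              ((‖Φ.ψ X‖₊ : ℝ≥0∞)) ^ 2) ≤ ENNReal.ofReal (θ * N) := by
  obtain ⟨R, hR, hv0⟩ := hv.exists_pos_range
  have hfin : scatteringLength v ≠ ⊤ := scatteringLength_ne_top_of_finiteRange hv0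
  set a₀ : ℝ := (scatteringLength v).toReal with ha₀
  have ha₀pos : 0 < a₀ := ENNReal.toReal_pos hapos.ne' hfin
  obtain ⟨P, ρh, ℓ₁, hP, hρh, hℓ₁, -, hpen⟩ := exists_crowdedCell_penalty hv hfin hapos
  -- a subcritical cap
  set ρbar : ℝ := 1 / (2 * (1 + R) ^ 3) with hρbar
  have hρbar0 : 0 < ρbar := by positivity
  have hsmall : ρbar * (1 + R) ^ 3 < 1 := by
    rw [hρbar, div_mul_eq_mul_div, one_mul, div_lt_one (by positivity)]
    nlinarith [pow_pos (by linarith : 0 < 1 + R) 3]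
  have hcap : ENNReal.ofReal ρbar ≤ criticalDensity v := ofReal_le_criticalDensity hv.1 hv0 hR hρbar0 hsmall
  -- the Dyson–LSSY upper bound on `e⁺`
  obtain ⟨Cu, ρu, hCu, hρu, Hup⟩ := eventually_groundStateEnergy_le_dyson hv0 hv.1 hfin hapos
  have hebound : ∀ y : ℝ, 0 < y → y < ρu → y * a₀ ^ 3 ≤ 1 →
      (limsupEnergyPerParticle v y).toReal ≤ 4 * Real.pi * y * a₀ * (1 + Cu) := by
    intro y hy hyu hya
    have hC0 : 0 ≤ 4 * Real.pi * y * a₀ * (1 + Cu * (y * a₀ ^ 3) ^ ((1 : ℝ) / 3)) := by positivity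
    have h1 := limsupEnergyPerParticle_le_of_eventually hC0 (Hup y hy hyu)
    have h2 := ENNReal.toReal_mono ENNReal.ofReal_ne_top h1
    rw [ENNReal.toReal_ofReal hC0] at h2
    refine h2.trans ?_
    have h3 : (y * a₀ ^ 3) ^ ((1 : ℝ) / 3) ≤ 1 := Real.rpow_le_one (by positivity) hya (by norm_num)
    have h4 : Cu * (y * a₀ ^ 3) ^ ((1 : ℝ) / 3) ≤ Cu := by nlinarith
    have : 0 ≤ 4 * Real.pi * y * a₀ := by positivity
    nlinarith
  -- the density threshold
  set ρ₀ : ℝ := min (min (ρbar / 4) (ρu / 4)) (min (1 / (2 * a₀ ^ 3)) (P / (64 * Real.pi * a₀ * (1 + Cu))))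
    with hρ₀
  have hρ₀pos : 0 < ρ₀ := by positivity
  refine ⟨ρ₀, hρ₀pos, fun ρ hρ hρlt s hs hs1 θ hθ κ hκ => ?_⟩
  have hρ1 : ρ < ρbar / 4 := hρlt.trans_le ((min_le_left _ _).trans (min_le_left _ _))
  have hρ2 : ρ < ρu / 4 := hρlt.trans_le ((min_le_left _ _).trans (min_le_right _ _))
  have hρ3 : ρ < 1 / (2 * a₀ ^ 3) := hρlt.trans_le ((min_le_right _ _).trans (min_le_left _ _))
  have hρ4 : ρ < P / (64 * Real.pi * a₀ * (1 + Cu)) :=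
    hρlt.trans_le ((min_le_right _ _).trans (min_le_right _ _))
  have h2ρbar : 2 * ρ < ρbar := by linarith
  have hρc : ENNReal.ofReal ρ < criticalDensity v :=
    lt_of_lt_of_le ((ENNReal.ofReal_lt_ofReal_iff hρbar0).2 (by linarith)) hcap
  -- the slope condition `2 e⁺(2ρ) ≤ P/4`
  have hD : 2 * (limsupEnergyPerParticle v (2 * ρ)).toReal ≤ P / 4 := by
    have hya : 2 * ρ * a₀ ^ 3 ≤ 1 := by
      rw [lt_div_iff₀ (by positivity)] at hρ3; linarith
    have h := hebound (2 * ρ) (by linarith) (by linarith) hya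
    have h64 : ρ * (64 * Real.pi * a₀ * (1 + Cu)) ≤ P := by
      rw [lt_div_iff₀ (by positivity)] at hρ4; linarith
    nlinarith
  -- thermodynamic inputs at `ρ`
  set e : ℝ → ℝ := fun x => (limsupEnergyPerParticle v x).toReal with he
  have heρT : limsupEnergyPerParticle v ρ ≠ ⊤ :=
    (limsupEnergyPerParticle_lt_top_of_lt_criticalDensity hρ hρc).ne
  have hT := tendsto_energyPerParticleDirichlet_of_lt_criticalDensity hv hρ hρc
  have hcont := continuousAt_toReal_limsupEnergyPerParticle hv hρ hρc
  -- the parameters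
  set ε : ℝ := P * θ / 16 with hε
  have hε0 : 0 < ε := by positivity
  set δ : ℝ := max 1 (Real.pi ^ 4 / (3 * P * θ)) with hδ
  have hδ1 : 1 ≤ δ := le_max_left _ _
  set ℓ₀ : ℝ := max ℓ₁ (δ + 2) with hℓ₀
  have hℓ₀1 : ℓ₁ ≤ ℓ₀ := le_max_left _ _
  have hℓ₀δ : δ + 2 ≤ ℓ₀ := le_max_right _ _
  have hℓ₀pos : 0 < ℓ₀ := by linarith [le_max_right ℓ₁ (δ + 2)]
  -- (E1) the energies at density `ρ` are eventually `≤ N (e(ρ) + ε)`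
  have hE1 : ∀ᶠ N : ℕ in atTop, groundStateEnergy v N (sideLength ρ N) ≤
      ENNReal.ofReal ((e ρ + ε) * N) := by
    have hlt : limsupEnergyPerParticle v ρ < limsupEnergyPerParticle v ρ + ENNReal.ofReal ε :=
      ENNReal.lt_add_right heρT (by simpa using hε0)
    filter_upwards [(tendsto_order.1 hT).2 _ hlt, eventually_gt_atTop 0] with N hN hN0
    have hN0' : (N : ℝ≥0∞) ≠ 0 := Nat.cast_ne_zero.2 hN0.ne'
    unfold energyPerParticleDirichlet at hN
    rw [ENNReal.div_lt_iff (Or.inl hN0') (Or.inl (ENNReal.natCast_ne_top N))] at hN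
    refine hN.le.trans (le_of_eq ?_)
    rw [ENNReal.ofReal_mul (by positivity), ENNReal.ofReal_natCast, ENNReal.ofReal_add
      ENNReal.toReal_nonneg hε0.le, ENNReal.ofReal_toReal heρT]
  -- (E2) continuity of `e` at `ρ`
  obtain ⟨η, hη, hηe⟩ : ∃ η > 0, ∀ x, dist x ρ < η → dist (e x) (e ρ) < ε :=
    Metric.continuousAt_iff.1 hcont ε hε0
  -- (E3) the window densities are eventually within `η` of `ρ`
  have hE3 : ∀ᶠ N : ℕ in atTop, ρ - η < (N : ℝ) / ((1 + κ / N) * sideLength ρ N + 2 * R) ^ 3 :=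
    (tendsto_order.1 (tendsto_window_density hρ hκ.le hR.le)).1 _ (by linarith)
  -- (E4)–(E6) sizes
  have hE4 : ∀ᶠ N : ℕ in atTop, 2 * ℓ₀ ≤ sideLength ρ N :=
    (tendsto_sideLength_atTop hρ).eventually_ge_atTop _
  have hE5 : ∀ᶠ N : ℕ in atTop, 1024 * ρh * ℓ₀ / (ρ * θ) ≤ sideLength ρ N :=
    (tendsto_sideLength_atTop hρ).eventually_ge_atTop _
  have hE6 : ∀ᶠ N : ℕ in atTop, max κ (16 / (3 * P * θ)) ≤ (N : ℝ) :=
    tendsto_natCast_atTop_atTop.eventually_ge_atTop _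
  filter_upwards [hE1, hE3, hE4, hE5, hE6, eventually_gt_atTop 0] with N hN1 hN3 hN4 hN5 hN6 hN0
    L' hL' Φ hΦ a
  have hNr : (0 : ℝ) < N := Nat.cast_pos.2 hN0
  have hLN : 0 < sideLength ρ N := sideLength_pos_of_pos hρ hN0
  have hκN : κ ≤ N := (le_max_left _ _).trans hN6
  have hN16 : 16 / (3 * P * θ) ≤ N := (le_max_right _ _).trans hN6
  obtain ⟨hL'lo, hL'hi⟩ := hL'
  have h1κ : 1 + κ / N ≤ 2 := by
    have : κ / N ≤ 1 := (div_le_one hNr).2 hκN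
    linarith
  have hL'2 : L' ≤ 2 * sideLength ρ N := hL'hi.trans (by nlinarith)
  have hL'pos : 0 < L' := hLN.trans_le hL'lo
  -- the window density
  set ρs : ℝ := N / (L' + 2 * R) ^ 3 with hρs
  have hρsρ : ρs ≤ ρ := by
    have h3 : sideLength ρ N ^ 3 = N / ρ := sideLength_pow_three hρ N
    have hle : sideLength ρ N ^ 3 ≤ (L' + 2 * R) ^ 3 :=
      pow_le_pow_left₀ hLN.le (by linarith) 3
    rw [hρs, div_le_iff₀ (by positivity)]
    calc (N : ℝ) = ρ * sideLength ρ N ^ 3 := by rw [h3]; field_simp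
      _ ≤ ρ * (L' + 2 * R) ^ 3 := mul_le_mul_of_nonneg_left hle hρ.le
  have hρslo : ρ - η < ρs := by
    refine hN3.trans_le ?_
    rw [hρs]
    exact div_le_div_of_nonneg_left hNr.le (by positivity)
      (pow_le_pow_left₀ (by positivity) (by linarith) 3)
  have heρs : e ρ ≤ e ρs + ε := by
    have hd : dist ρs ρ < η := by
      rw [Real.dist_eq, abs_lt]; constructor <;> linarith
    have := hηe ρs hd
    rw [Real.dist_eq, abs_lt] at this
    linarith
  -- the energy hypothesis of the core estimate
  have hΦ' : energy v Φ ≤ ENNReal.ofReal (N * (e ρs + 2 * ε)) + 1 := by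
    calc energy v Φ ≤ groundStateEnergy v N L' + 1 := hΦ
      _ ≤ groundStateEnergy v N (sideLength ρ N) + 1 :=
          add_le_add (groundStateEnergy_anti v N hL'lo) le_rfl
      _ ≤ ENNReal.ofReal ((e ρ + ε) * N) + 1 := add_le_add hN1 le_rfl
      _ ≤ ENNReal.ofReal (N * (e ρs + 2 * ε)) + 1 := by
          rw [mul_comm]
          exact add_le_add (ENNReal.ofReal_le_ofReal
            (mul_le_mul_of_nonneg_left (by linarith) hNr.le)) le_rfl
  -- the core estimate
  have hcore := slab_le_of_bracketing hv hR hv0 hcap hP hρh hpen hN0 hδ1 hℓ₀1 hℓ₀δ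
    (hN4.trans hL'lo) hs1 hε0.le hρsρ h2ρbar hD Φ hΦ' a
  refine hcore.trans (ENNReal.ofReal_le_ofReal ?_)
  -- the four terms
  have ht1 : 4 / (3 * P) * (2 * ε * N) = θ * N / 6 := by rw [hε]; field_simp; ring
  have ht2 : 4 / (3 * P) * 1 ≤ θ * N / 4 := slack_term_le hP hθ hN16
  have ht3 : 4 / (3 * P) * (N * (Real.pi ^ 2 / (4 * δ)) ^ 2) ≤ θ * N / 4 :=
    ims_term_le hP hθ hδ1 (le_max_right _ _) hNr.le
  have ht4 : 4 / (3 * P) * (4 * P * ρh * ℓ₀ * L' ^ 2) ≤ θ * N / 4 := by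
    have h3 : sideLength ρ N ^ 3 = N / ρ := sideLength_pow_three hρ N
    have hN' : (N : ℝ) = ρ * sideLength ρ N ^ 3 := by rw [h3]; field_simp
    have hL2 : L' ^ 2 ≤ 4 * sideLength ρ N ^ 2 :=
      calc L' ^ 2 ≤ (2 * sideLength ρ N) ^ 2 := pow_le_pow_left₀ hL'pos.le hL'2 2
        _ = 4 * sideLength ρ N ^ 2 := by ring
    exact offset_term_le hP hθ hρh hℓ₀pos hρ hLN hN5 hL2 hN'
  have htot : 4 / (3 * P) * (2 * ε * N + 1 + N * (Real.pi ^ 2 / (4 * δ)) ^ 2 +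
      4 * P * ρh * ℓ₀ * L' ^ 2) = 4 / (3 * P) * (2 * ε * N) + 4 / (3 * P) * 1 +
        4 / (3 * P) * (N * (Real.pi ^ 2 / (4 * δ)) ^ 2) +
          4 / (3 * P) * (4 * P * ρh * ℓ₀ * L' ^ 2) := by ring
  rw [htot, ht1]
  have hθN : 0 ≤ θ * N := by positivity
  linarith

end Literature.MathematicalPhysics.QuantumManyBody.BoseGas

end
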